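import Summits.QuantumFields.YangMills.Theorems.FlatTubeReductionPinnedUnitStepExStub1
import Summits.QuantumFields.YangMills.Theorems.FlatTubeReductionPinnedUnitStepExMomentumFloor

/-!
# PinnedUnitStepEx (stmt-QuantumFields-27561) — CANDIDATE skeleton «ti-split-1» v4 (NOT registered; planner/LEAD verb `ledger skeleton check`)

Prepared by prover leafhand-qf-flattubereduction-1 g0 (2026-08-30) for the planner of record (ym-idea-1).  Finest split of the v2 stub
`stub_pinnedAutocorrExTI1` this seat's doors support (all landed: ZeroMomentum p793618/p793894, SplitDoor p793860/p794159/p794600, SplitDefs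
p794322/p794846, MomentumFloor p795078/p795235):

* stub 1 `stub_smearVarPosGS1` — CLOSED in the tree (p642758), used by name;
* `stub_femtoLevels : FemtoLevelsOfRecord` — the EXISTING ladder leaf N34 (`Theorems/FemtoTransferGapLevels.lean`; only its `k = 1` lower half
  «first excitation cheap» is used; fed by RED `RunningReduction` via `femtoLevels_of_reduction`) — XL, SHARED with the ladder, not new work;
* `stub_nonZeroMomentumFloorTI1 : NonZeroMomentumFloorTI1` — NEW (P1)-content: lam-uniform non-zero-momentum energy floor `κ/L′` — size M–L;
* `stub_oneStepPinnedComparisonTI1 : OneStepPinnedComparisonTI1` — (P2), the two-cutoff wall — XL.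

Composition `PinnedUnitStepEx_holds_of_stubs : PinnedUnitStepEx` kernel-checked modulo the three `sorry`s.  Alternative v3 (two stubs:
`NonZeroMomentumGapTI1`, `OneStepPinnedComparisonTI1`) is `Lines/ti_split_1_v3.lean`.  No summit is proved by any line.
-/

namespace Summit.QuantumFields.YangMills.Cruxes.PinnedUnitStepEx.TISplit1

open Summit.QuantumFields.YangMills.Theses.FlatTubeReduction
open Summit.QuantumFields.YangMills.Theorems.FemtoTransferGap

/-- STUB (XL, shared ladder leaf N34): the two-sided femto levels law. -/
theorem stub_femtoLevels : FemtoLevelsOfRecord := by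
  sorry

/-- STUB (M–L, new): the lam-uniform non-zero-momentum floor along the window. -/
theorem stub_nonZeroMomentumFloorTI1 : NonZeroMomentumFloorTI1 := by
  sorry

/-- STUB (XL): (P2) one-step pinned comparison for every TI coarse excitation. -/
theorem stub_oneStepPinnedComparisonTI1 : OneStepPinnedComparisonTI1 := by
  sorry

/-- The v2 stub 2, recovered from the three stubs (doors p795078 + p794159). -/
theorem pinnedAutocorrExTI1_of_v4_stubs : PinnedAutocorrExTI1 :=
  pinnedAutocorrExTI1_of_levels_of_floor_of_oneStep stub_femtoLevels stub_nonZeroMomentumFloorTI1 stub_oneStepPinnedComparisonTI1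

/-- Kernel-checked composition: the stubs give `PinnedUnitStepEx` (27561) by name (stub 1 = landed `stub_smearVarPosGS1`, p642758). -/
theorem PinnedUnitStepEx_holds_of_stubs : PinnedUnitStepEx := by
  have hA : SmearVarPosGS1 := stub_smearVarPosGS1
  obtain ⟨C, lam0, hlam0, H⟩ := pinnedAutocorrExTI1_of_v4_stubs
  refine ⟨C, lam0, hlam0, fun lam hl hle => ?_⟩
  obtain ⟨L0, H'⟩ := H lam hl hle
  refine ⟨L0, ?_⟩
  intro L' _ hL0 β β' hw hw' hΛ Ω hΩ hpos hn hE Ω' hΩ' c' hc' hlow hn' hE'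
  obtain ⟨φ', hφ', hTI, horth, hn1, hE1, hB⟩ := H' L' hL0 β β' hw hw' hΛ Ω hΩ hpos hn hE Ω' hΩ' c' hc' hlow hn' hE'
  exact ⟨φ', hφ', horth, hn1, hE1, ⟨hA L' β' Ω hΩ hpos hn Ω' hΩ' c' hc' hlow hn' hE' φ' hφ' hTI horth hn1, hB⟩⟩

end Summit.QuantumFields.YangMills.Cruxes.PinnedUnitStepEx.TISplit1
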